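import Mathlib.Geometry.Manifold.ContMDiffMFDeriv
import Mathlib.Geometry.Manifold.MFDeriv.Tangent
import Mathlib.Geometry.Manifold.Instances.Real
import Mathlib.Geometry.Manifold.VectorBundle.MDifferentiable
import Mathlib.Analysis.Calculus.ContDiff.Operations
import Mathlib.Analysis.InnerProductSpace.PiL2
import Mathlib.Analysis.Normed.Operator.Bilinear
import HarnessLib

/-!
# Route SullivanDual, support item `AdmissibleJExists` (stmt-SmoothPoincare4-7830), II:
# smooth frames and coframes of a tangent bundle read in tangent coordinates

Helper file (pure proofs, no definitions) for the conditional closure of `AdmissibleJExists`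
(`SullivanDualAdmissibleJExistsOfFraming.lean`). Continues
`SullivanDualAdmissibleJExists.lean` (§1–§4 there: `J = Ψ⁻¹ J₀ Ψ` for a coframe `Ψ`).

* §A (any `C^∞` manifold `N` modelled on a complete normed space `EN`, coframes
  `Ψ_x : T_x N → F` read in tangent coordinates `inTangentCoordinates I 𝓘(ℝ, F) id g Ψ x₀`):
  the tangent coordinate changes `x₀ → x`, `x → x₀` are inverse isomorphisms on the chart domain
  (`exists_equiv_tangentCoordChange`, cocycle rule), whence the inversion rules
  `inverse_comp_tangentCoordChange`, `inverse_tangentCoordChange_comp`; the reading of a coframe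
  is `Ψ_x ∘ (change x₀ → x)` (`inTangentCoordinates_coframe_eq`); if the reading is `C^∞` at `x₀`
  and `Ψ_{x₀}` is invertible then its pointwise inverse is `C^∞` at `x₀`
  (`contMDiffAt_inverse_inTangentCoordinates_coframe`, `contDiffAt_map_inverse`) and every
  column `x ↦ Ψ_x⁻¹ u` is a `C^∞` SECTION of `TN` at `x₀` (`contMDiffAt_inverse_coframe_section`,
  Mathlib's `contMDiffAt_section`).
* §B (an `n`-manifold modelled on `ℝⁿ`): the frame map `c ↦ Σ cᵢ vᵢ` of `n` vectors of `ℝⁿ`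
  (`frameMap_single`, `isInvertible_frameMap` for a linearly independent family, `comp_frameMap`,
  `contMDiffAt_frameMap`), and **a smooth global frame gives a smooth coframe**
  (`exists_coframe_of_frame`): for `C^∞` vector fields `s₁, …, sₙ` forming a basis everywhere,
  the dual coframe `Ψ_x (sᵢ x) = eᵢ` is invertible and `C^∞` read in tangent coordinates.

References: Steenrod 1951 §6–7 (frames, sections); Mathlib `VectorBundle/Basic`,
`ContMDiffMFDeriv`.
-/

-- the registered namespace `Summit.SmoothPoincare4.SmoothPoincare4.Theorems` repeats a component
set_option linter.dupNamespace false

open scoped Manifold ContDiff Topology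
open Set Function ContinuousLinearMap

namespace Summit.SmoothPoincare4.SmoothPoincare4.Theorems.SullivanDual

/-! ### §A Coframes read in tangent coordinates: inverses and sections -/

section CoframeReadings

variable {EN : Type*} [NormedAddCommGroup EN] [NormedSpace ℝ EN] [CompleteSpace EN]
  {HN : Type*} [TopologicalSpace HN] {I : ModelWithCorners ℝ EN HN}
  {N : Type*} [TopologicalSpace N] [ChartedSpace HN N] [IsManifold I ∞ N]
  {F : Type*} [NormedAddCommGroup F] [NormedSpace ℝ F]

variable {EN : Type*} [NormedAddCommGroup EN] [NormedSpace ℝ EN] [CompleteSpace EN]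
  {HN : Type*} [TopologicalSpace HN] {I : ModelWithCorners ℝ EN HN}
  {N : Type*} [TopologicalSpace N] [ChartedSpace HN N] [IsManifold I ∞ N]
  {F : Type*} [NormedAddCommGroup F] [NormedSpace ℝ F]

omit [CompleteSpace EN] in
/-- On the chart domain of `x₀`, the tangent coordinate changes `x₀ → x` and `x → x₀` at `x` are
inverse isomorphisms (cocycle rule); packaged as a continuous linear equivalence with the two
coercions definitionally the coordinate changes. [folklore] -/
theorem exists_equiv_tangentCoordChange {x₀ x : N} (hx : x ∈ (extChartAt I x₀).source) :
    ∃ e : EN ≃L[ℝ] EN, (e : EN →L[ℝ] EN) = tangentCoordChange I x₀ x x ∧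
      (e.symm : EN →L[ℝ] EN) = tangentCoordChange I x x₀ x := by
  refine ⟨ContinuousLinearEquiv.equivOfInverse' (tangentCoordChange I x₀ x x)
    (tangentCoordChange I x x₀ x) ?_ ?_, rfl, rfl⟩
  · ext v
    have h3 : x ∈ (extChartAt I x).source ∩ (extChartAt I x₀).source ∩ (extChartAt I x).source :=
      ⟨⟨mem_extChartAt_source x, hx⟩, mem_extChartAt_source x⟩
    simp only [ContinuousLinearMap.coe_comp, Function.comp_apply]
    rw [tangentCoordChange_comp h3, tangentCoordChange_self (mem_extChartAt_source x)]
    rfl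
  · ext v
    have h3 : x ∈ (extChartAt I x₀).source ∩ (extChartAt I x).source ∩ (extChartAt I x₀).source :=
      ⟨⟨hx, mem_extChartAt_source x⟩, hx⟩
    simp only [ContinuousLinearMap.coe_comp, Function.comp_apply]
    rw [tangentCoordChange_comp h3, tangentCoordChange_self hx]
    rfl

omit [CompleteSpace EN] in
/-- `(f ∘ (change x₀ → x))⁻¹ = (change x → x₀) ∘ f⁻¹` on the chart domain of `x₀`
(`ContinuousLinearMap.inverse`, junk-compatible). [folklore] -/
theorem inverse_comp_tangentCoordChange {x₀ x : N} (hx : x ∈ (extChartAt I x₀).source)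
    (f : EN →L[ℝ] F) :
    (f ∘L tangentCoordChange I x₀ x x).inverse = tangentCoordChange I x x₀ x ∘L f.inverse := by
  obtain ⟨e, he, hes⟩ := exists_equiv_tangentCoordChange (I := I) hx
  rw [← he, ContinuousLinearMap.inverse_comp_equiv, hes]

omit [CompleteSpace EN] in
/-- `((change x → x₀) ∘ f)⁻¹ = f⁻¹ ∘ (change x₀ → x)` on the chart domain of `x₀`. [folklore] -/
theorem inverse_tangentCoordChange_comp {x₀ x : N} (hx : x ∈ (extChartAt I x₀).source)
    (f : F →L[ℝ] EN) :
    (tangentCoordChange I x x₀ x ∘L f).inverse = f.inverse ∘L tangentCoordChange I x₀ x x := by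
  obtain ⟨e, he, hes⟩ := exists_equiv_tangentCoordChange (I := I) hx
  rw [← hes, ContinuousLinearMap.inverse_equiv_comp, ContinuousLinearEquiv.symm_symm, he]

omit [CompleteSpace EN] in
/-- A coframe read in tangent coordinates at `x₀` along an auxiliary map into the normed space
`F` is, on the chart domain of `x₀`, `Ψ_x ∘ (change x₀ → x)` (the trivialisations of `TF` are the
identity). [folklore] -/
theorem inTangentCoordinates_coframe_eq (Ψ : N → EN →L[ℝ] F) (g : N → F) {x₀ x : N}
    (hx : x ∈ (chartAt HN x₀).source) :
    inTangentCoordinates I 𝓘(ℝ, F) (id : N → N) g Ψ x₀ x = Ψ x ∘L tangentCoordChange I x₀ x x := by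
  rw [inTangentCoordinates_eq _ _ _ hx (by simp), tangentBundleCore_coordChange_model_space,
    ContinuousLinearMap.id_comp]
  rfl

/-- **Smoothness of the inverse coframe.** If the coframe `Ψ` read in tangent coordinates at `x₀`
is `C^∞` at `x₀` and `Ψ_{x₀}` is invertible, then `x ↦ (its reading)⁻¹` is `C^∞` at `x₀`
(`contDiffAt_map_inverse`). [folklore] -/
theorem contMDiffAt_inverse_inTangentCoordinates_coframe (Ψ : N → EN →L[ℝ] F) (g : N → F)
    {x₀ : N} (hΨ : ContMDiffAt I 𝓘(ℝ, EN →L[ℝ] F) ∞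
      (inTangentCoordinates I 𝓘(ℝ, F) (id : N → N) g Ψ x₀) x₀)
    (hinv : (Ψ x₀).IsInvertible) :
    ContMDiffAt I 𝓘(ℝ, F →L[ℝ] EN) ∞
      (fun x => (inTangentCoordinates I 𝓘(ℝ, F) (id : N → N) g Ψ x₀ x).inverse) x₀ := by
  have hG0 : inTangentCoordinates I 𝓘(ℝ, F) (id : N → N) g Ψ x₀ x₀ = Ψ x₀ := by
    rw [inTangentCoordinates_coframe_eq Ψ g (mem_chart_source HN x₀)]
    ext v
    simp only [ContinuousLinearMap.coe_comp, Function.comp_apply]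
    rw [tangentCoordChange_self (mem_extChartAt_source x₀)]
  obtain ⟨e₀, he₀⟩ : (inTangentCoordinates I 𝓘(ℝ, F) (id : N → N) g Ψ x₀ x₀).IsInvertible :=
    hG0 ▸ hinv
  have h1 : ContDiffAt ℝ ∞ ContinuousLinearMap.inverse
      (inTangentCoordinates I 𝓘(ℝ, F) (id : N → N) g Ψ x₀ x₀) := by
    rw [← he₀]; exact contDiffAt_map_inverse e₀
  exact h1.comp_contMDiffAt hΨ

/-- **Smooth coframes have smooth inverse columns**: under the same hypotheses, for every `u ∈ F`
the vector field `x ↦ Ψ_x⁻¹ u` is a `C^∞` section of `TN` at `x₀` (its reading in the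
trivialisation at `x₀` is `G(x)⁻¹ u`, `G` the reading of `Ψ`; `contMDiffAt_section`).
[folklore] -/
theorem contMDiffAt_inverse_coframe_section (Ψ : N → EN →L[ℝ] F) (g : N → F) {x₀ : N}
    (hΨ : ContMDiffAt I 𝓘(ℝ, EN →L[ℝ] F) ∞
      (inTangentCoordinates I 𝓘(ℝ, F) (id : N → N) g Ψ x₀) x₀)
    (hinv : (Ψ x₀).IsInvertible) (u : F) :
    ContMDiffAt I I.tangent ∞
      (fun x => (Bundle.TotalSpace.mk' EN x ((Ψ x).inverse u) : TangentBundle I N)) x₀ := by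
  have key : ContMDiffAt I 𝓘(ℝ, EN) ∞
      (fun x => tangentCoordChange I x x₀ x ((Ψ x).inverse u)) x₀ := by
    refine ((contMDiffAt_inverse_inTangentCoordinates_coframe Ψ g hΨ hinv).clm_apply
      (contMDiffAt_const (c := u))).congr_of_eventuallyEq ?_
    filter_upwards [(chartAt HN x₀).open_source.mem_nhds (mem_chart_source HN x₀)] with x hx
    have hx' : x ∈ (extChartAt I x₀).source := by rwa [extChartAt_source]
    rw [inTangentCoordinates_coframe_eq Ψ g hx, inverse_comp_tangentCoordChange hx']
    rfl
  rw [Bundle.contMDiffAt_section]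
  exact key

end CoframeReadings

/-! ### §B From a smooth global frame to a smooth coframe -/

section Frame

open Bundle

variable {n : ℕ} {N : Type*} [TopologicalSpace N] [ChartedSpace (EuclideanSpace ℝ (Fin n)) N]
  [IsManifold (𝓡 n) ∞ N]

/-- **The frame map** of a family of `n` tangent vectors `v i ∈ ℝⁿ`: `c ↦ Σᵢ cᵢ vᵢ`, as a
continuous linear map; it sends the `i`-th standard basis vector to `v i`. [folklore] -/
theorem frameMap_single (v : Fin n → EuclideanSpace ℝ (Fin n)) (i : Fin n) :
    (∑ j, (EuclideanSpace.proj (𝕜 := ℝ) j).smulRight (v j)) (EuclideanSpace.single i (1 : ℝ)) = v i := by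
  classical
  simp only [_root_.sum_apply, ContinuousLinearMap.smulRight_apply,
    PiLp.proj_apply, PiLp.single_apply, ite_smul, one_smul, zero_smul,
    Finset.sum_ite_eq', Finset.mem_univ, if_true]

/-- The frame map of a linearly independent family of `n` vectors of `ℝⁿ` is invertible
(an injective linear endomorphism of a finite-dimensional space is bijective). [folklore] -/
theorem isInvertible_frameMap {v : Fin n → EuclideanSpace ℝ (Fin n)}
    (hv : LinearIndependent ℝ v) :
    (∑ j, (EuclideanSpace.proj (𝕜 := ℝ) j).smulRight (v j) :
      EuclideanSpace ℝ (Fin n) →L[ℝ] EuclideanSpace ℝ (Fin n)).IsInvertible := by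
  set f : EuclideanSpace ℝ (Fin n) →L[ℝ] EuclideanSpace ℝ (Fin n) :=
    ∑ j, (EuclideanSpace.proj (𝕜 := ℝ) j).smulRight (v j) with hf
  have happly : ∀ c : EuclideanSpace ℝ (Fin n), f c = ∑ j, c j • v j := fun c => by
    simp only [hf, _root_.sum_apply, ContinuousLinearMap.smulRight_apply,
      PiLp.proj_apply]
  have hinj : Function.Injective f := by
    refine (injective_iff_map_eq_zero f).mpr fun c hc => ?_
    rw [happly] at hc
    have h0 := Fintype.linearIndependent_iff.mp hv (fun j => c j) hc
    ext j
    exact h0 j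
  have hbij : Function.Bijective (f : EuclideanSpace ℝ (Fin n) →ₗ[ℝ] EuclideanSpace ℝ (Fin n)) :=
    ⟨hinj, (LinearMap.injective_iff_surjective).mp hinj⟩
  exact ⟨(LinearEquiv.ofBijective _ hbij).toContinuousLinearEquiv, by ext; rfl⟩

/-- Post-composition with a linear map acts on the frame map column by column. [folklore] -/
theorem comp_frameMap (g : EuclideanSpace ℝ (Fin n) →L[ℝ] EuclideanSpace ℝ (Fin n))
    (v : Fin n → EuclideanSpace ℝ (Fin n)) :
    g ∘L (∑ j, (EuclideanSpace.proj (𝕜 := ℝ) j).smulRight (v j)) =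
      ∑ j, (EuclideanSpace.proj (𝕜 := ℝ) j).smulRight (g (v j)) := by
  rw [ContinuousLinearMap.comp_finsetSum]
  congr 1
  ext j c
  simp only [ContinuousLinearMap.coe_comp, Function.comp_apply,
    ContinuousLinearMap.smulRight_apply, map_smul]

/-- The frame map depends smoothly (indeed linearly) on the columns: if each column
`x ↦ v j x` is `C^∞` at `x₀` then so is `x ↦ (c ↦ Σ cⱼ vⱼ(x))`. [folklore] -/
theorem contMDiffAt_frameMap {X : Type*} [TopologicalSpace X] {H : Type*} [TopologicalSpace H]
    {EX : Type*} [NormedAddCommGroup EX] [NormedSpace ℝ EX] {IX : ModelWithCorners ℝ EX H}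
    [ChartedSpace H X] {v : Fin n → X → EuclideanSpace ℝ (Fin n)} {x₀ : X}
    (hv : ∀ j, ContMDiffAt IX 𝓘(ℝ, EuclideanSpace ℝ (Fin n)) ∞ (v j) x₀) :
    ContMDiffAt IX 𝓘(ℝ, EuclideanSpace ℝ (Fin n) →L[ℝ] EuclideanSpace ℝ (Fin n)) ∞
      (fun x => ∑ j, (EuclideanSpace.proj (𝕜 := ℝ) j).smulRight (v j x)) x₀ := by
  have h : ∀ j, ContMDiffAt IX 𝓘(ℝ, EuclideanSpace ℝ (Fin n) →L[ℝ] EuclideanSpace ℝ (Fin n)) ∞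
      (fun x => (EuclideanSpace.proj (𝕜 := ℝ) j).smulRight (v j x)) x₀ := fun j =>
    (ContinuousLinearMap.smulRightL ℝ (EuclideanSpace ℝ (Fin n)) (EuclideanSpace ℝ (Fin n))
      (EuclideanSpace.proj (𝕜 := ℝ) j)).contDiff.contDiffAt
        |>.comp_contMDiffAt (hv j)
  simpa only [← Finset.sum_apply] using ContMDiffAt.sum (t := Finset.univ) fun j _ => h j

/-- **A smooth global frame gives a smooth coframe.** Let `s₁, …, sₙ` be `C^∞` vector fields on
an `n`-manifold `N` (sections of `TN`, smooth into the tangent bundle) which form a basis of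
`T_x N` at every point. Then the dual coframe `Ψ_x : T_x N → ℝⁿ`, `Ψ_x (sᵢ x) = eᵢ` (the
inverse of the frame map), is invertible at every point and `C^∞` read in tangent coordinates
(`inTangentCoordinates`, along any auxiliary map into `ℝⁿ`): in the chart at `x₀` its reading
is the inverse of the frame map of the readings of the `sᵢ` in the trivialisation of `TN` at
`x₀`, which are `C^∞` by Mathlib's characterisation of smooth sections (`contMDiffAt_section`).
[folklore] -/
theorem exists_coframe_of_frame (s : Fin n → ∀ x : N, TangentSpace (𝓡 n) x)
    (hs : ∀ i, ContMDiff (𝓡 n) (𝓡 n).tangent ∞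
      fun x => (TotalSpace.mk' (EuclideanSpace ℝ (Fin n)) x (s i x) : TangentBundle (𝓡 n) N))
    (hli : ∀ x, LinearIndependent ℝ fun i => s i x) (g : N → EuclideanSpace ℝ (Fin n)) :
    ∃ Ψ : N → EuclideanSpace ℝ (Fin n) →L[ℝ] EuclideanSpace ℝ (Fin n),
      (∀ x, (Ψ x).IsInvertible) ∧
      (∀ x₀, ContMDiffAt (𝓡 n) 𝓘(ℝ, EuclideanSpace ℝ (Fin n) →L[ℝ] EuclideanSpace ℝ (Fin n)) ∞
        (inTangentCoordinates (𝓡 n) 𝓘(ℝ, EuclideanSpace ℝ (Fin n)) (id : N → N) g Ψ x₀) x₀) ∧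
      ∀ x i, Ψ x (s i x) = EuclideanSpace.single i 1 := by
  -- the frame maps `f x : c ↦ Σ cᵢ sᵢ(x)` and their inverses
  let f : N → EuclideanSpace ℝ (Fin n) →L[ℝ] EuclideanSpace ℝ (Fin n) :=
    fun x => ∑ j, (EuclideanSpace.proj (𝕜 := ℝ) j).smulRight (s j x)
  have hfinv : ∀ x, (f x).IsInvertible := fun x => isInvertible_frameMap (hli x)
  refine ⟨fun x => (f x).inverse, fun x => (hfinv x).inverse, fun x₀ => ?_, fun x i => ?_⟩
  · -- readings of the sections in the trivialisation at `x₀`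
    let S : Fin n → N → EuclideanSpace ℝ (Fin n) := fun i x => tangentCoordChange (𝓡 n) x x₀ x (s i x)
    have hS : ∀ i, ContMDiffAt (𝓡 n) 𝓘(ℝ, EuclideanSpace ℝ (Fin n)) ∞ (S i) x₀ := fun i =>
      (contMDiffAt_section (s := fun x => s i x) x₀).mp (hs i x₀)
    -- the frame map `F` of the readings, smooth at `x₀` and equal to `f x₀` there
    set F : N → EuclideanSpace ℝ (Fin n) →L[ℝ] EuclideanSpace ℝ (Fin n) :=
      fun x => ∑ j, (EuclideanSpace.proj (𝕜 := ℝ) j).smulRight (S j x) with hFdef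
    have hF : ContMDiffAt (𝓡 n) 𝓘(ℝ, EuclideanSpace ℝ (Fin n) →L[ℝ] EuclideanSpace ℝ (Fin n)) ∞
        F x₀ := contMDiffAt_frameMap (IX := 𝓡 n) hS
    have hF0 : F x₀ = f x₀ := by
      simp only [hFdef, S, tangentCoordChange_self (mem_extChartAt_source (I := 𝓡 n) x₀)]
      rfl
    obtain ⟨e₀, he₀⟩ : (F x₀).IsInvertible := hF0 ▸ hfinv x₀
    have hInv : ContMDiffAt (𝓡 n) 𝓘(ℝ, EuclideanSpace ℝ (Fin n) →L[ℝ] EuclideanSpace ℝ (Fin n)) ∞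
        (fun x => (F x).inverse) x₀ := by
      have h1 : ContDiffAt ℝ ∞ ContinuousLinearMap.inverse (F x₀) := by
        rw [← he₀]; exact contDiffAt_map_inverse e₀
      exact h1.comp_contMDiffAt hF
    refine hInv.congr_of_eventuallyEq ?_
    filter_upwards [(chartAt (EuclideanSpace ℝ (Fin n)) x₀).open_source.mem_nhds
      (mem_chart_source (EuclideanSpace ℝ (Fin n)) x₀)] with x hx
    have hx' : x ∈ (extChartAt (𝓡 n) x₀).source := by rwa [extChartAt_source]
    rw [inTangentCoordinates_coframe_eq _ _ hx]
    change (f x).inverse ∘L tangentCoordChange (𝓡 n) x₀ x x = (F x).inverse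
    rw [← inverse_tangentCoordChange_comp hx' (f x), hFdef, comp_frameMap]
  · -- `Ψ_x (sᵢ x) = eᵢ`
    have h := frameMap_single (fun j => s j x) i
    exact (hfinv x).inverse_apply_eq.mpr h.symm

end Frame

end Summit.SmoothPoincare4.SmoothPoincare4.Theorems.SullivanDual
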